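import Summits.MatrixMultiplication.OmegaCensus.SmallFormats.HenselLiftObstruction444
import Summits.MatrixMultiplication.OmegaCensus.SmallFormats.HenselLiftObstruction445
import HarnessLib

/-!
# ω-census family (a): from "no `ℤ/4ℤ` lift" to "no integer lift" — the tree-held `𝔽₂` record schemes are reductions of no integer scheme

Cell `pub-omega` (unit `pub-omega-tensor`, gen 2), topic `Summits/MatrixMultiplication/OmegaCensus`.  Framing (verbatim):
lottery ticket; floor = certified bounds/negative ranges.  HONEST FRAMING: a short general lemma plus two corollaries about
explicit published objects; not progress on `ω`.

`HenselObstruction.not_intLift_of_not_zmod4Lift`: if an `𝔽₂` scheme (integer tables `c1 c2 c3`, `MatMulCellCheck` slot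
conventions) is the reduction of no rank-`R` decomposition of `⟨k,m,n⟩` over `ℤ/4ℤ`, then it is the reduction of no rank-`R`
decomposition over `ℤ` either (reduce an integer decomposition modulo `4`).  Corollaries for the tree-held Kauers–Moosbauer
schemes `⟨4,4,4⟩:47` and `⟨4,4,5⟩:60` over `𝔽₂` (`SchemeMod2_444/445.not_liftsToZMod4`, kernel certificates of the companion
files): **no integer scheme with `47` (resp. `60`) products is congruent to them modulo `2`** — the precise content of
"cannot be lifted" (Kauers–Moosbauer, ISSAC 2023, §5) for these two objects.  (The same one-line corollary applies to
`⟨4,5,5⟩:73` once `SchemeMod2_455.not_liftsToZMod4` is in the tree.)  Theorems only.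

## References
* M. Kauers, J. Moosbauer, *Flip graphs for matrix multiplication*, ISSAC 2023, arXiv:2212.01175, §5. [KauersMoosbauer2022FlipGraphs]
-/

namespace Summit.MatrixMultiplication.OmegaCensus

open scoped BigOperators
open Literature.Computability.AlgebraicComplexity
open Literature.Computability.AlgebraicComplexity.MatMulCellCheck

namespace HenselObstruction

/-- **No `ℤ/4ℤ` lift ⇒ no integer lift.** If no rank-`R` decomposition of `⟨k,m,n⟩` over `ℤ/4ℤ` reduces mod `2` to the
tables, then no rank-`R` decomposition over `ℤ` is congruent to the tables mod `2`. -/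
theorem not_intLift_of_not_zmod4Lift (k m n R : ℕ) (c1 c2 c3 : List (List ℤ))
    (h : ¬ ∃ (w : Fin R → Fin k × Fin n → ZMod 4) (u : Fin R → Fin k × Fin m → ZMod 4)
        (v : Fin R → Fin m × Fin n → ZMod 4),
      (∀ t a, ZMod.castHom (show 2 ∣ 4 by norm_num) (ZMod 2) (w t a) = ((tz c1 t.val (a.2.val + n * a.1.val) : ℤ) : ZMod 2)) ∧
      (∀ t b, ZMod.castHom (show 2 ∣ 4 by norm_num) (ZMod 2) (u t b) = ((tz c2 t.val (b.2.val + m * b.1.val) : ℤ) : ZMod 2)) ∧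
      (∀ t c, ZMod.castHom (show 2 ∣ 4 by norm_num) (ZMod 2) (v t c) = ((tz c3 t.val (c.2.val + n * c.1.val) : ℤ) : ZMod 2)) ∧
      matMulTensor (ZMod 4) k m n = ∑ t, triad (w t) (u t) (v t)) :
    ¬ ∃ (W : Fin R → Fin k × Fin n → ℤ) (U : Fin R → Fin k × Fin m → ℤ) (V : Fin R → Fin m × Fin n → ℤ),
      (∀ t a, W t a ≡ tz c1 t.val (a.2.val + n * a.1.val) [ZMOD 2]) ∧
      (∀ t b, U t b ≡ tz c2 t.val (b.2.val + m * b.1.val) [ZMOD 2]) ∧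
      (∀ t c, V t c ≡ tz c3 t.val (c.2.val + n * c.1.val) [ZMOD 2]) ∧
      matMulTensor ℤ k m n = ∑ t, triad (W t) (U t) (V t) := by
  rintro ⟨W, U, V, hW, hU, hV, hdec⟩
  apply h
  refine ⟨fun t a => ((W t a : ℤ) : ZMod 4), fun t b => ((U t b : ℤ) : ZMod 4), fun t c => ((V t c : ℤ) : ZMod 4),
    ?_, ?_, ?_, ?_⟩
  · intro t a
    rw [map_intCast]
    exact (ZMod.intCast_eq_intCast_iff' ..).2 (by simpa [Int.ModEq] using hW t a)
  · intro t b
    rw [map_intCast]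
    exact (ZMod.intCast_eq_intCast_iff' ..).2 (by simpa [Int.ModEq] using hU t b)
  · intro t c
    rw [map_intCast]
    exact (ZMod.intCast_eq_intCast_iff' ..).2 (by simpa [Int.ModEq] using hV t c)
  · funext a b c
    have he := congr_fun (congr_fun (congr_fun hdec a) b) c
    rw [Finset.sum_apply, Finset.sum_apply, Finset.sum_apply] at he ⊢
    simp only [triad_apply] at he ⊢
    have hc := congrArg (Int.castRingHom (ZMod 4)) he
    rw [map_sum] at hc
    simp only [map_mul, eq_intCast] at hc
    rw [← hc]
    unfold matMulTensor
    split_ifs <;> simp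

end HenselObstruction

/-- **The tree-held Kauers–Moosbauer `𝔽₂` scheme `⟨4,4,4⟩:47` is congruent modulo `2` to no integer scheme with `47`
products** ("cannot be lifted", Kauers–Moosbauer 2023 §5; kernel certificate `SchemeMod2_444.not_liftsToZMod4`). -/
theorem SchemeMod2_444.not_intLift :
    ¬ ∃ (W : Fin 47 → Fin 4 × Fin 4 → ℤ) (U : Fin 47 → Fin 4 × Fin 4 → ℤ) (V : Fin 47 → Fin 4 × Fin 4 → ℤ),
      (∀ t a, W t a ≡ tz SchemeMod2_444.c1 t.val (a.2.val + 4 * a.1.val) [ZMOD 2]) ∧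
      (∀ t b, U t b ≡ tz SchemeMod2_444.c2 t.val (b.2.val + 4 * b.1.val) [ZMOD 2]) ∧
      (∀ t c, V t c ≡ tz SchemeMod2_444.c3 t.val (c.2.val + 4 * c.1.val) [ZMOD 2]) ∧
      matMulTensor ℤ 4 4 4 = ∑ t, triad (W t) (U t) (V t) :=
  HenselObstruction.not_intLift_of_not_zmod4Lift 4 4 4 47 _ _ _ SchemeMod2_444.not_liftsToZMod4

/-- **The tree-held Kauers–Moosbauer `𝔽₂` scheme `⟨4,4,5⟩:60` is congruent modulo `2` to no integer scheme with `60`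
products** (kernel certificate `SchemeMod2_445.not_liftsToZMod4`). -/
theorem SchemeMod2_445.not_intLift :
    ¬ ∃ (W : Fin 60 → Fin 4 × Fin 5 → ℤ) (U : Fin 60 → Fin 4 × Fin 4 → ℤ) (V : Fin 60 → Fin 4 × Fin 5 → ℤ),
      (∀ t a, W t a ≡ tz SchemeMod2_445.c1 t.val (a.2.val + 5 * a.1.val) [ZMOD 2]) ∧
      (∀ t b, U t b ≡ tz SchemeMod2_445.c2 t.val (b.2.val + 4 * b.1.val) [ZMOD 2]) ∧
      (∀ t c, V t c ≡ tz SchemeMod2_445.c3 t.val (c.2.val + 5 * c.1.val) [ZMOD 2]) ∧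
      matMulTensor ℤ 4 4 5 = ∑ t, triad (W t) (U t) (V t) :=
  HenselObstruction.not_intLift_of_not_zmod4Lift 4 4 5 60 _ _ _ SchemeMod2_445.not_liftsToZMod4

end Summit.MatrixMultiplication.OmegaCensus
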